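import Literature.Analysis.OperatorTheory.Enflo2023.RoomClaim
import Mathlib.Analysis.InnerProductSpace.l2Space
import HarnessLib

/-!
# Enflo (2023/24), Part B, p. 20 — tightness of the pivot-room bound; one pivot is not enough

Formalisation status: companion to `PivotRoom.lean` (the p. 20 room claim of P. H. Enflo, *On the invariant
subspace problem in Hilbert spaces*, arXiv:2305.15442v2, bib key `Enflo2023`, FOLLOWS for the constraint
vector (46) names); part of a **claimed result under adjudication** — nothing here asserts the manuscript's
theorem.  This file is a MODEL: it shows what a single (46)-constraint does NOT give.

`PivotRoom.room_sq_le_of_endpoint_constraint`: with the exact side condition `⟨x₀ − v_P, v_{k+1} − v_k⟩ = 0`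
from the pivot `P` on, `‖v_n − v_P‖² ≤ 11 ((εθ)_P − (εθ)_n)`.  Here, in any complex inner-product space with
an orthonormal sequence `e₀, e₁, e₂, …`, the sequence
  `x₀ = e₀`,  `v_n = (9/20) e₀ + √(19/80) e₁ + √((εθ)₀ − (εθ)_n) e_{n+2}`,  `(εθ)_n = 10⁻² 2⁻ⁿ`,  `β = 1/2`
satisfies EVERY hypothesis of `RoomClaim46` except the wait (`‖x₀‖ = 1`; window `Re⟨x₀, v_n⟩ = 0.45`;
(16) `⟨v_n, x₀ − v_n⟩ = (εθ)_n`; `(εθ)_n > 0`, strictly decreasing to `0`, ratio `1/2 = 1 − β`; (45) with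
`⟨x₀, v_{n+1} − v_n⟩ = 0`; the exact ENDPOINT side condition `⟨x₀ − v₀, v_{n+1} − v_n⟩ = 0`), and moreover
the exact PIVOT side condition `⟨v₀, v_{n+1} − v_n⟩ = 0` and the norm window `0.3 ≤ ‖v_n‖ ≤ 0.7`, while
* `‖v_n − v₀‖² = (εθ)₀ − (εθ)_n` EXACTLY (`norm_sub_pivot_sq`) — the order `(εθ)_P − (εθ)_n` of the
  pivot-room bound is attained (constant `1` against `11`);
* `‖v_{n+1} − v_n‖² = 2(εθ)₀ − (εθ)_n − (εθ)_{n+1} ≥ 1/200` (`norm_step_sq`, `norm_step_sq_ge`), so `(v_n)`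
  is NOT Cauchy (`not_cauchySeq`): one pivot confines the Main-Construction output to a ball of radius
  `≍ √(εθ)_P` and no better; the text's RE-PIVOTING (`w₀₁, w₀₂, …`, v2 p. 20) at ever smaller `(εθ)` is
  necessary — and, by `PivotRoom.cauchySeq_of_repivoting`, sufficient.
`single_pivot_tight` packages this as an existence statement on `ℓ²(ℕ, ℂ)`.

Reading as in `PivotRoom.lean`: `v n = [ ]⁻¹_n x₀`; Mathlib's `⟪a, b⟫_ℂ` is conjugate-linear in `a`.
-/

open scoped InnerProductSpace
open Filter Topology RCLike

namespace Literature.Analysis.OperatorTheory.Enflo2023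

namespace PivotRoomTight

open RoomModel (epsModel epsModel_pos epsModel_le epsModel_succ epsModel_strictAnti epsModel_tendsto)

variable {H : Type*} [NormedAddCommGroup H] [InnerProductSpace ℂ H]

/-! ### The scalars -/

/-- `(εθ)₀ = 1/100`. [cite: Enflo2023, v2 p.20, after (46)] -/
lemma epsModel_zero : epsModel 0 = 1 / 100 := by unfold epsModel; norm_num

/-- `(εθ)_n ≤ (εθ)₀`. [cite: Enflo2023, v2 p.20, after (46)] -/
lemma epsModel_le_zero (n : ℕ) : epsModel n ≤ epsModel 0 :=
  epsModel_strictAnti.antitone (Nat.zero_le n)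

/-- the fixed transverse coefficient `b = √(19/80)`. [cite: Enflo2023, v2 p.20, after (46)] -/
noncomputable def bP : ℝ := Real.sqrt (19 / 80)

/-- `b² = 19/80`. [cite: Enflo2023, v2 p.20, after (46)] -/
lemma bP_sq : bP ^ 2 = 19 / 80 := by unfold bP; rw [Real.sq_sqrt]; norm_num

/-- the radial coefficient `d_n = √((εθ)₀ − (εθ)_n)`. [cite: Enflo2023, v2 p.20, after (46)] -/
noncomputable def dP (n : ℕ) : ℝ := Real.sqrt (epsModel 0 - epsModel n)

/-- `d_n² = (εθ)₀ − (εθ)_n`. [cite: Enflo2023, v2 p.20, after (46)] -/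
lemma dP_sq (n : ℕ) : dP n ^ 2 = epsModel 0 - epsModel n := by
  unfold dP; rw [Real.sq_sqrt]; linarith [epsModel_le_zero n]

/-- `d₀ = 0`: at the pivot the radial coefficient vanishes. [cite: Enflo2023, v2 p.20, after (46)] -/
lemma dP_zero : dP 0 = 0 := by unfold dP; simp

/-! ### The model sequence -/

/-- THE MODEL `v n = (9/20) e₀ + b e₁ + d_n e_{n+2}` (`x₀ = e₀`). [cite: Enflo2023, v2 p.20, after (46)] -/
noncomputable def vP (e : ℕ → H) (n : ℕ) : H :=
  ((9 / 20 : ℝ) : ℂ) • e 0 + ((bP : ℝ) : ℂ) • e 1 + ((dP n : ℝ) : ℂ) • e (n + 2)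

variable {e : ℕ → H} (he : Orthonormal ℂ e)
include he

/-- Inner products of the orthonormal sequence. [cite: Enflo2023, v2 p.20, after (46)] -/
private lemma e_inner (i j : ℕ) : ⟪e i, e j⟫_ℂ = if i = j then 1 else 0 :=
  orthonormal_iff_ite.mp he i j

/-- `⟪e i, e i⟫ = 1`. [cite: Enflo2023, v2 p.20, after (46)] -/
private lemma e_self (i : ℕ) : ⟪e i, e i⟫_ℂ = 1 := by rw [e_inner he]; simp

/-- `⟪e i, e j⟫ = 0` for `i ≠ j`. [cite: Enflo2023, v2 p.20, after (46)] -/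
private lemma e_ne {i j : ℕ} (h : i ≠ j) : ⟪e i, e j⟫_ℂ = 0 := by rw [e_inner he]; simp [h]

omit he in
/-- At the pivot: `v 0 = (9/20) e₀ + b e₁`. [cite: Enflo2023, v2 p.20, after (46)] -/
lemma vP_zero : vP e 0 = ((9 / 20 : ℝ) : ℂ) • e 0 + ((bP : ℝ) : ℂ) • e 1 := by
  unfold vP; rw [dP_zero]; simp

omit he in
/-- `v n − v 0 = d_n e_{n+2}`. [cite: Enflo2023, v2 p.20, after (46)] -/
lemma vP_sub_zero (n : ℕ) : vP e n - vP e 0 = ((dP n : ℝ) : ℂ) • e (n + 2) := by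
  rw [vP_zero]; unfold vP; abel

omit he in
/-- the step `v (n+1) − v n = d_{n+1} e_{n+3} − d_n e_{n+2}`. [cite: Enflo2023, v2 p.20, after (46)] -/
lemma vP_succ_sub (n : ℕ) : vP e (n + 1) - vP e n
    = ((dP (n + 1) : ℝ) : ℂ) • e (n + 3) - ((dP n : ℝ) : ℂ) • e (n + 2) := by
  unfold vP
  have : n + 1 + 2 = n + 3 := by omega
  rw [this]; abel

/-- window: `⟪x₀, v n⟫ = 9/20`. [cite: Enflo2023, v2 p.20, after (46)] -/
lemma inner_x0_vP (n : ℕ) : ⟪e 0, vP e n⟫_ℂ = ((9 / 20 : ℝ) : ℂ) := by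
  unfold vP
  rw [inner_add_right, inner_add_right, inner_smul_right, inner_smul_right, inner_smul_right, e_self he,
    e_ne he (show 0 ≠ 1 by omega), e_ne he (show 0 ≠ n + 2 by omega)]
  simp

/-- window: `0.3 ≤ Re⟪x₀, v n⟫ ≤ 0.7`. [cite: Enflo2023, v2 p.20, after (46)] -/
lemma re_inner_x0_vP_window (n : ℕ) :
    (0.3 : ℝ) ≤ re ⟪e 0, vP e n⟫_ℂ ∧ re ⟪e 0, vP e n⟫_ℂ ≤ 0.7 := by
  rw [inner_x0_vP he]
  simp only [RCLike.re_to_complex, Complex.ofReal_re]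
  norm_num

/-- `⟪v n, v n⟫ = (9/20)² + b² + d_n²`. [cite: Enflo2023, v2 p.20, after (46)] -/
lemma inner_vP_vP (n : ℕ) :
    ⟪vP e n, vP e n⟫_ℂ = (((9 / 20 : ℝ) ^ 2 + bP ^ 2 + dP n ^ 2 : ℝ) : ℂ) := by
  unfold vP
  have h01 := e_ne he (show 0 ≠ 1 by omega)
  have h10 := e_ne he (show 1 ≠ 0 by omega)
  have h0n := e_ne he (show 0 ≠ n + 2 by omega)
  have hn0 := e_ne he (show n + 2 ≠ 0 by omega)
  have h1n := e_ne he (show 1 ≠ n + 2 by omega)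
  have hn1 := e_ne he (show n + 2 ≠ 1 by omega)
  simp only [inner_add_left, inner_add_right, inner_smul_left, inner_smul_right, e_self he, h01, h10,
    h0n, hn0, h1n, hn1, Complex.conj_ofReal]
  push_cast; ring

omit he in
/-- the coefficients: `(9/20)² + b² + d_n² = 0.45 − (εθ)_n`. [cite: Enflo2023, v2 p.20, after (46)] -/
lemma coeff_sq (n : ℕ) : (9 / 20 : ℝ) ^ 2 + bP ^ 2 + dP n ^ 2 = 0.45 - epsModel n := by
  rw [bP_sq, dP_sq, epsModel_zero]; ring

/-- `‖v n‖² = 0.45 − (εθ)_n`. [cite: Enflo2023, v2 p.20, after (46)] -/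
lemma norm_vP_sq (n : ℕ) : ‖vP e n‖ ^ 2 = 0.45 - epsModel n := by
  have key := inner_vP_vP he n
  rw [@inner_self_eq_norm_sq_to_K ℂ H _ _ _ (vP e n)] at key
  have key' : (‖vP e n‖ ^ 2 : ℝ) = (9 / 20 : ℝ) ^ 2 + bP ^ 2 + dP n ^ 2 := by
    apply Complex.ofReal_injective
    push_cast
    first | exact key | simpa using key
  rw [key', coeff_sq]

/-- norm window: `0.3 ≤ ‖v n‖ ≤ 0.7` (indeed `‖v n‖² ∈ [0.44, 0.45]`). [cite: Enflo2023, v2 p.20, after (46)] -/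
lemma norm_vP_window (n : ℕ) : (0.3 : ℝ) ≤ ‖vP e n‖ ∧ ‖vP e n‖ ≤ 0.7 := by
  have h := norm_vP_sq he n
  have h1 := epsModel_le n; have h2 := epsModel_pos n
  have hn := norm_nonneg (vP e n)
  constructor <;> nlinarith

/-- (16): `⟪v n, x₀ − v n⟫ = (εθ)_n` — the defining relation of `(εθ)_n`. [cite: Enflo2023, v2 p.5 (16), p.20] -/
lemma inner_vP_x0_sub_vP (n : ℕ) : ⟪vP e n, e 0 - vP e n⟫_ℂ = (epsModel n : ℂ) := by
  rw [inner_sub_right, inner_vP_vP he, ← inner_conj_symm, inner_x0_vP he]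
  have := coeff_sq n
  simp only [Complex.conj_ofReal]
  norm_cast
  rw [this]; ring

/-- (45) trivially: the step is orthogonal to `x₀`. [cite: Enflo2023, v2 p.19 (45), p.20] -/
lemma inner_x0_step (n : ℕ) : ⟪e 0, vP e (n + 1) - vP e n⟫_ℂ = 0 := by
  rw [vP_succ_sub, inner_sub_right, inner_smul_right, inner_smul_right,
    e_ne he (show 0 ≠ n + 3 by omega), e_ne he (show 0 ≠ n + 2 by omega)]
  simp

/-- `⟪e₁, step⟫ = 0`. [cite: Enflo2023, v2 p.20, after (46)] -/
lemma inner_e1_step (n : ℕ) : ⟪e 1, vP e (n + 1) - vP e n⟫_ℂ = 0 := by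
  rw [vP_succ_sub, inner_sub_right, inner_smul_right, inner_smul_right,
    e_ne he (show 1 ≠ n + 3 by omega), e_ne he (show 1 ≠ n + 2 by omega)]
  simp

/-- THE EXACT ENDPOINT SIDE CONDITION of (46)/v1: `⟪x₀ − v 0, v (n+1) − v n⟫ = 0`. [cite: Enflo2023, v2 p.20 (46); v1 p.13] -/
lemma inner_endpoint_step (n : ℕ) : ⟪e 0 - vP e 0, vP e (n + 1) - vP e n⟫_ℂ = 0 := by
  rw [vP_zero, inner_sub_left, inner_add_left, inner_smul_left, inner_smul_left, inner_x0_step he,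
    inner_e1_step he]
  simp

/-- THE EXACT PIVOT SIDE CONDITION: `⟪v 0, v (n+1) − v n⟫ = 0`. [cite: Enflo2023, v2 p.20, after (46)] -/
lemma inner_pivot_step (n : ℕ) : ⟪vP e 0, vP e (n + 1) - vP e n⟫_ℂ = 0 := by
  rw [vP_zero, inner_add_left, inner_smul_left, inner_smul_left, inner_x0_step he, inner_e1_step he]
  simp

/-- TIGHTNESS: `‖v n − v 0‖² = (εθ)₀ − (εθ)_n` exactly (the bound of
`PivotRoom.room_sq_le_of_endpoint_constraint` is `11((εθ)₀ − (εθ)_n)`). [cite: Enflo2023, v2 p.20, after (46)] -/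
theorem norm_sub_pivot_sq (n : ℕ) : ‖vP e n - vP e 0‖ ^ 2 = epsModel 0 - epsModel n := by
  rw [vP_sub_zero, norm_smul, Complex.norm_real, Real.norm_eq_abs, mul_pow, sq_abs, dP_sq]
  have : ‖e (n + 2)‖ = 1 := he.1 (n + 2)
  rw [this]; ring

/-- the squared step: `‖v (n+1) − v n‖² = d_{n+1}² + d_n² = 2(εθ)₀ − (εθ)_{n+1} − (εθ)_n`. [cite: Enflo2023, v2 p.20, after (46)] -/
theorem norm_step_sq (n : ℕ) :
    ‖vP e (n + 1) - vP e n‖ ^ 2 = 2 * epsModel 0 - epsModel (n + 1) - epsModel n := by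
  have key : (⟪vP e (n + 1) - vP e n, vP e (n + 1) - vP e n⟫_ℂ)
      = ((dP (n + 1) ^ 2 + dP n ^ 2 : ℝ) : ℂ) := by
    rw [vP_succ_sub]
    have h1 := e_ne he (show n + 3 ≠ n + 2 by omega)
    have h2 := e_ne he (show n + 2 ≠ n + 3 by omega)
    simp only [inner_sub_left, inner_sub_right, inner_smul_left, inner_smul_right, e_self he, h1, h2,
      Complex.conj_ofReal]
    push_cast; ring
  have h := @inner_self_eq_norm_sq_to_K ℂ H _ _ _ (vP e (n + 1) - vP e n)
  rw [h] at key
  have key' : (‖vP e (n + 1) - vP e n‖ ^ 2 : ℝ) = dP (n + 1) ^ 2 + dP n ^ 2 := by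
    apply Complex.ofReal_injective
    push_cast
    first | exact key | simpa using key
  rw [key', dP_sq, dP_sq]; ring

/-- every step has squared length `≥ 1/200 = (εθ)₀/2`. [cite: Enflo2023, v2 p.20, after (46)] -/
theorem norm_step_sq_ge (n : ℕ) : (1 / 200 : ℝ) ≤ ‖vP e (n + 1) - vP e n‖ ^ 2 := by
  rw [norm_step_sq he, epsModel_succ, epsModel_zero]
  have := epsModel_le n
  linarith

/-- ONE PIVOT IS NOT ENOUGH: the model is not Cauchy. [cite: Enflo2023, v2 p.20, after (46)] -/
theorem not_cauchySeq : ¬ CauchySeq (vP e) := by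
  intro hc
  obtain ⟨N, hN⟩ := Metric.cauchySeq_iff.mp hc (1 / 20) (by norm_num)
  have h := hN (N + 1) (by omega) N le_rfl
  rw [dist_eq_norm] at h
  have h2 := norm_step_sq_ge he N
  nlinarith [norm_nonneg (vP e (N + 1) - vP e N)]

end PivotRoomTight

/-! ### Packaged: the hypotheses of `RoomClaim46` without the wait do not give Cauchy -/

namespace PivotRoomTight

open RoomModel (epsModel epsModel_pos epsModel_succ epsModel_strictAnti epsModel_tendsto)

/-- `ℓ²(ℕ, ℂ)`. [folklore] -/
abbrev ℓ2N : Type := lp (fun _ : ℕ => ℂ) 2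

/-- the standard unit vectors of `ℓ²(ℕ, ℂ)`. [folklore] -/
noncomputable def eN (k : ℕ) : ℓ2N := lp.single 2 k (1 : ℂ)

/-- the standard unit vectors are orthonormal. [folklore] -/
lemma orthonormal_eN : Orthonormal ℂ eN := by
  classical
  rw [orthonormal_iff_ite]
  intro i j
  unfold eN
  rw [lp.inner_single_left, lp.single_apply]
  by_cases h : i = j
  · subst h; simp
  · rw [Pi.single_eq_of_ne h]; simp [h]

/-- SINGLE PIVOT, TIGHT: on `ℓ²(ℕ, ℂ)` there are `x₀`, `v`, `(εθ)`, `β` satisfying every hypothesis of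
`RoomClaim46` except the wait — `‖x₀‖ = 1`, `0 < β < 1`, the window, (16), positivity, strict decrease to `0`,
the ratio law of (38), (45), the exact endpoint side condition of (46)/v1 — and also the exact pivot side
condition and the norm window `0.3 ≤ ‖v n‖ ≤ 0.7`, for which `‖v n − v 0‖² = (εθ)₀ − (εθ)_n` exactly and
`(v n)` is not Cauchy.  So the order of `PivotRoom.room_sq_le_of_endpoint_constraint` is attained and the
re-pivoting of p. 20 (`w₀₁, w₀₂, …`) is necessary for norm convergence. [cite: Enflo2023, v2 p.20, (46) and after] -/
theorem single_pivot_tight :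
    ∃ (x₀ : ℓ2N) (v : ℕ → ℓ2N) (εθ : ℕ → ℝ) (β : ℝ),
      ‖x₀‖ = 1 ∧ 0 < β ∧ β < 1 ∧
      (∀ n, (0.3 : ℝ) ≤ re ⟪x₀, v n⟫_ℂ ∧ re ⟪x₀, v n⟫_ℂ ≤ 0.7) ∧
      (∀ n, (0.3 : ℝ) ≤ ‖v n‖ ∧ ‖v n‖ ≤ 0.7) ∧
      (∀ n, (εθ n : ℂ) = ⟪v n, x₀ - v n⟫_ℂ) ∧
      (∀ n, 0 < εθ n) ∧ StrictAnti εθ ∧ Tendsto εθ atTop (𝓝 0) ∧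
      (∀ n, εθ (n + 1) ≤ (1 - β) * εθ n) ∧
      (∀ n, ‖⟪x₀, v (n + 1) - v n⟫_ℂ‖ ≤ 10 * β * εθ n) ∧
      (∀ n, ⟪x₀ - v 0, v (n + 1) - v n⟫_ℂ = 0) ∧
      (∀ n, ⟪v 0, v (n + 1) - v n⟫_ℂ = 0) ∧
      (∀ n, ‖v n - v 0‖ ^ 2 = εθ 0 - εθ n) ∧
      ¬ CauchySeq v := by
  have he := orthonormal_eN
  refine ⟨eN 0, vP eN, epsModel, 1 / 2, he.1 0, by norm_num, by norm_num,
    re_inner_x0_vP_window he, norm_vP_window he, fun n => (inner_vP_x0_sub_vP he n).symm,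
    epsModel_pos, epsModel_strictAnti, epsModel_tendsto, ?_, ?_, inner_endpoint_step he,
    inner_pivot_step he, norm_sub_pivot_sq he, not_cauchySeq he⟩
  · intro n; rw [epsModel_succ]; norm_num
  · intro n; rw [inner_x0_step he, norm_zero]; have := epsModel_pos n; positivity

end PivotRoomTight

end Literature.Analysis.OperatorTheory.Enflo2023
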